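import Summits.QuantumFields.YangMills.Theorems.FluctuationComparisonRegPrIntLS2BetaLiftLadderPerBlockRow
import Summits.QuantumFields.YangMills.Theorems.FluctuationComparisonRegPrIntLS2BetaFaceDiscrepancyOfLetters
import HarnessLib

/-!
# S2β · Q11l — THE PER-`B` DISCREPANCY ENERGY (the summand of the station's `D′`) FROM NAMED LETTERS ONLY, and its SOURCE∕FEEDBACK SPLIT (ONE name each; `SU(2)`, `blockAvg ℰ`)

Cell `ym3-torus` (rung R3 = continuum `SU(2)` YM₃ on T³ at fixed lattice data — NOT d = 4, NOT infinite volume, NOT a mass gap, NOT Clay).  Width seat `ym3-torus-px5` (gen 23);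
crux `stmt-QuantumFields-20520`, LINE g18-1 S2β, the sup chain GAP♯∘ ⟸ knit v6 ⟸ (ST‴) ⟸ station ✓p834059 ⟸ {`hTOP`, `hREC`, `hSCT_fb`}; `hSCT_fb` ⟸ px21 g25 (iii) `hSCT_of_discSplit`
⟸ {`hDisc : D′lam t ≤ X t + q·E′lam t`, `hX`} (architect px17 g22 21:29:46Z).  The per-`B` SUMMAND of px20's letter-free discrepancy energy `D′` (✓p832977 `liftRow'`, ✓p834992 `topRow'`;
px21 (i) `D′lam`) is the squared truncated Pi-norm `‖𝟙[pS ∧ ¬treecomb]·logVec (su2Quat (R_b⁻¹·η_b))‖²` whose UNSQUARED form is the left-hand side of ✓p833084 `pi_norm_disc_trunc_le_perBlock`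
(sources `sF` = face letter, `ρ̃` = intra-block relative plaquettes).  THIS FILE composes it with ✓p834979 `hface_of_letters` exactly as ✓p835106 did for the full row:
§1 ★★★`pi_norm_disc_trunc_le_perBlock_of_letters` — `‖𝟙[pS ∧ ¬treecomb]·logVec (R⁻¹η)‖ ≤ s`, `s := sF + (π∕2)·((d−1)((L−1)∕2))·ρ̃`,
   `sF := (π∕2)·((ρκ + 2·aκ·(((L−1)∕2+1)·mR)) + ((d−1)((L−1)∕2))·(1+2·((L−1)∕2))·ρ̃)` — from the four letters `ρκ`, `aκ`, `mR`, `ρ̃` ONLY (no `hface`, no `sF` binder);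
§2 ★★`sq_pi_norm_disc_trunc_le_perBlock_of_letters` — the square (the `D′` summand): `≤ s²`;
§3 ★★`sq_pi_norm_disc_trunc_le_source_add_feedback` — the (SRC) SHAPE per `B`: `s = r + m` with the θ-LETTER part `r := (π∕2)·(ρκ + ((d−1)((L−1)∕2))·(2 + 2·((L−1)∕2))·ρ̃)` and the
   FEEDBACK part `m := π·aκ·(((L−1)∕2+1)·mR)` (`mR` = relative chord of the two LIFTED fields at the central face bond — it carries the PARENT relative field; its coefficient `aκ` =
   absolute correction rotation is the θ-small factor), and for every `κ′ > 0`: `‖…‖² ≤ (1+κ′)·r² + (1+κ′⁻¹)·m²` — summed over `B` this is px21 (iii)'s `hDisc` row `D′ ≤ X + q·E′`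
   once `m² ≤ (q-part)·E′` is fed by the lift formula (px12 ✓p835228 `dist1_liftChord_pair_le`); that feed and the Σ_B∕`bondShift` plumbing are NOT in this file.
`--kind proof --supports stmt-QuantumFields-20520 --as helper`, count-neutral, DEFINITION-FREE (0 `def`, 0 `instance`, 0 `notation`, 0 `sorry`, default heartbeats).

HONEST SCOPE.  A junction of landed lemmas and one elementary inequality `(r+m)² ≤ (1+κ′)r² + (1+κ′⁻¹)m²`; nothing of Bałaban's analysis is asserted or proved; the letters
`ρκ`∕`aκ`∕`mR`∕`ρ̃`, (T4)(T5), `hcomm`, the `wt`∕`lift` readings are HYPOTHESES; the feed `m² ≤ q·E′`, the Σ_B plumbing, `hX`, `hARC`, (ST‴)∕LOC‴, «MULT♭-ax»∕«CRIT-ax», h3,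
GAP♯∘ (`stub_uniformFibreGapOrbit`, registry 3732b7df UNTOUCHED, 0∕5), S2β, the five registered stubs, 20520, 19936, 19200, `YM3TorusSU2` are NOT proved; no summit statement is proved by a
helper; rung R3 — NOT d = 4, NOT infinite volume, NOT a mass gap, NOT Clay; the Yang–Mills mass gap is NOT proved.

References: T. Bałaban, CMP **102** (1985) 277–309 [Balaban1985RegularSpaces] ((1.19) p.79, (1.29) p.81); CMP **109** (1987) 249–301 [Balaban1987RG1] ((0.3)–(0.4) p.252); CMP **122**
(1989) 355–392 [Balaban1989LargeFieldII] (p.382).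
-/

set_option autoImplicit false

namespace Summit.QuantumFields.YangMills.Theorems.FluctuationComparisonRegPrIntLS2BetaDiscEnergyPerBlockOfLetters

open scoped Real
open Literature.MathematicalPhysics.QuantumLattice (su2Quat)
open Literature.MathematicalPhysics.QuantumFieldTheory.Balaban1983to89
open Literature.MathematicalPhysics.QuantumFieldTheory.Balaban1983to89.T4Continuum
open Literature.MathematicalPhysics.QuantumFieldTheory.Balaban1983to89.BlockAveraging
open Literature.MathematicalPhysics.QuantumFieldTheory.Balaban1983to89.AveragingRT
open Literature.MathematicalPhysics.QuantumFieldTheory.Balaban1983to89.B10Eq47AxialChi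
open B10Eq27TorusAxialLog (rel transl axialT)
open T4CubeChartGnomonic (SU2)
open T4HaarSU2ExpChart (expPoint)
open T4ExpWindowSmallField (logVec)
open Summit.QuantumFields.YangMills.Theorems.FluctuationComparisonRegPrIntLS2BetaLiftLadderPerBlockRow (pi_norm_disc_trunc_le_perBlock)
open Summit.QuantumFields.YangMills.Theorems.FluctuationComparisonRegPrIntLS2BetaFaceDiscrepancyOfLetters (hface_of_letters)

variable {P : Params}

/-! ## §1 The truncated discrepancy Pi-norm per `B` from the four letters -/

/-- ★★★ **THE TRUNCATED DISCREPANCY Pi-NORM PER `B` FROM NAMED LETTERS ONLY** (✓p833084 `pi_norm_disc_trunc_le_perBlock` with its face letter DISCHARGED by ✓p834979 `hface_of_letters`):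
on the `pS`-bonds off the tree comb, `‖𝟙·logVec (su2Quat (R_b⁻¹·η_b))‖ ≤ sF + (π∕2)·((d−1)·((L−1)∕2))·ρ̃` with
`sF = (π∕2)·((ρκ + 2·aκ·(((L−1)∕2+1)·mR)) + ((d−1)·((L−1)∕2))·(1+2·((L−1)∕2))·ρ̃)` — from `ρκ`, `aκ`, `mR` (face-crossing bonds) and `ρ̃` (relative plaquettes of the bond's block and its
`b.dir`-neighbour) only. [cite: Balaban1985RegularSpaces, (1.19) p.79; Balaban1987RG1, (0.3)-(0.4) p.252; Balaban1989LargeFieldII, p.382] -/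
theorem pi_norm_disc_trunc_le_perBlock_of_letters (ℰ : LoopAverage SU2) {j : ℕ} (hj : j + 1 ≤ P.m + P.K)
    (wt : (i : ℕ) → PBond P i → PBond P (i + 1) → ℝ) (lift : (i : ℕ) → GaugeField P (i + 1) SU2 → GaugeField P i SU2)
    (g g₀ : (i : ℕ) → Site P i → SU2) (U U₁ : GaugeField P 0 SU2)
    (hwt : ∀ b e, wt j b e = if e.dir = b.dir ∧ (b.src b.dir - emb e.src b.dir).val < P.L then
      ∏ ν ∈ Finset.univ.erase b.dir, max 0 (1 - ((rel (emb e.src) b.src ν).natAbs : ℝ) / P.L) else 0)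
    (hlift : ∀ (X : GaugeField P (j + 1) SU2) (b : PBond P j), lift j X b = expPoint (∑ e, wt j b e • ((P.L : ℝ)⁻¹ • logVec (su2Quat (X e)))))
    (hT4 : ∀ x, axialT (GaugeField.gaugeAct (g j) (Averaging.iter (fun i => blockAvg (P := P) (j := i) ℰ) j U)) (emb (blockOf x)) x =
      axialT (lift j (GaugeField.gaugeAct (g (j + 1)) (Averaging.iter (fun i => blockAvg (P := P) (j := i) ℰ) (j + 1) U))) (emb (blockOf x)) x)
    (hT4' : ∀ x, axialT (GaugeField.gaugeAct (g₀ j) (Averaging.iter (fun i => blockAvg (P := P) (j := i) ℰ) j U₁)) (emb (blockOf x)) x =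
      axialT (lift j (GaugeField.gaugeAct (g₀ (j + 1)) (Averaging.iter (fun i => blockAvg (P := P) (j := i) ℰ) (j + 1) U₁))) (emb (blockOf x)) x)
    (hT5 : (blockAvg (P := P) (j := j) ℰ).avg (GaugeField.gaugeAct (g j) (Averaging.iter (fun i => blockAvg (P := P) (j := i) ℰ) j U)) =
      GaugeField.gaugeAct (g (j + 1)) (Averaging.iter (fun i => blockAvg (P := P) (j := i) ℰ) (j + 1) U))
    (hT5' : (blockAvg (P := P) (j := j) ℰ).avg (GaugeField.gaugeAct (g₀ j) (Averaging.iter (fun i => blockAvg (P := P) (j := i) ℰ) j U₁)) =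
      GaugeField.gaugeAct (g₀ (j + 1)) (Averaging.iter (fun i => blockAvg (P := P) (j := i) ℰ) (j + 1) U₁))
    (hcomm : ∀ x y : SU2, dist1 (x * y * x⁻¹ * y⁻¹) ≤ 2 * dist1 x * dist1 y)
    (pS : PBond P j → Prop) [DecidablePred pS] {ρκ aκ mR ρt : ℝ} (hρκ0 : 0 ≤ ρκ) (haκ0 : 0 ≤ aκ) (hmR : 0 ≤ mR) (hρ0 : 0 ≤ ρt)
    (hκrel : ∀ b : PBond P j, pS b → blockOf (b.src.shift b.dir) ≠ blockOf b.src →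
      dist1 (corr ℰ (GaugeField.gaugeAct (g j) (Averaging.iter (fun i => blockAvg (P := P) (j := i) ℰ) j U)) ⟨blockOf b.src, b.dir⟩ *
        (corr ℰ (GaugeField.gaugeAct (g₀ j) (Averaging.iter (fun i => blockAvg (P := P) (j := i) ℰ) j U₁)) ⟨blockOf b.src, b.dir⟩)⁻¹) ≤ ρκ)
    (hκabs : ∀ b : PBond P j, pS b → blockOf (b.src.shift b.dir) ≠ blockOf b.src →
      dist1 (corr ℰ (GaugeField.gaugeAct (g₀ j) (Averaging.iter (fun i => blockAvg (P := P) (j := i) ℰ) j U₁)) ⟨blockOf b.src, b.dir⟩) ≤ aκ)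
    (hR : ∀ b : PBond P j, pS b → blockOf (b.src.shift b.dir) ≠ blockOf b.src →
      dist1 (lift j (GaugeField.gaugeAct (g (j + 1)) (Averaging.iter (fun i => blockAvg (P := P) (j := i) ℰ) (j + 1) U))
            ⟨transl (emb (blockOf b.src)) (fun ν => if ν = b.dir then (((P.L - 1) / 2 : ℕ) : ℤ) else 0), b.dir⟩ *
          (lift j (GaugeField.gaugeAct (g₀ (j + 1)) (Averaging.iter (fun i => blockAvg (P := P) (j := i) ℰ) (j + 1) U₁))
            ⟨transl (emb (blockOf b.src)) (fun ν => if ν = b.dir then (((P.L - 1) / 2 : ℕ) : ℤ) else 0), b.dir⟩)⁻¹) ≤ mR)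
    (hρ : ∀ q : Plaq P j, (∃ b : PBond P j, pS b ∧ (blockOf q.src = blockOf b.src ∨ blockOf q.src = (blockOf b.src).shift b.dir)) →
      dist1 ((GaugeField.plaqHol (fun b => lift j (GaugeField.gaugeAct (g (j + 1)) (Averaging.iter (fun i => blockAvg (P := P) (j := i) ℰ) (j + 1) U)) b *
            (lift j (GaugeField.gaugeAct (g₀ (j + 1)) (Averaging.iter (fun i => blockAvg (P := P) (j := i) ℰ) (j + 1) U₁)) b)⁻¹ *
          GaugeField.gaugeAct (g₀ j) (Averaging.iter (fun i => blockAvg (P := P) (j := i) ℰ) j U₁) b : GaugeField P j SU2) q)⁻¹ *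
        GaugeField.plaqHol (GaugeField.gaugeAct (g j) (Averaging.iter (fun i => blockAvg (P := P) (j := i) ℰ) j U)) q) ≤ ρt) :
    ‖(fun b : PBond P j =>
        if pS b ∧ ¬ (blockOf (b.src.shift b.dir) = blockOf b.src ∧ ∀ ν, ν < b.dir → rel (emb (blockOf b.src)) b.src ν = 0) then
          logVec (su2Quat ((lift j (GaugeField.gaugeAct (g (j + 1)) (Averaging.iter (fun i => blockAvg (P := P) (j := i) ℰ) (j + 1) U)) b *
              (lift j (GaugeField.gaugeAct (g₀ (j + 1)) (Averaging.iter (fun i => blockAvg (P := P) (j := i) ℰ) (j + 1) U₁)) b)⁻¹)⁻¹ *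
            (GaugeField.gaugeAct (g j) (Averaging.iter (fun i => blockAvg (P := P) (j := i) ℰ) j U) b *
              (GaugeField.gaugeAct (g₀ j) (Averaging.iter (fun i => blockAvg (P := P) (j := i) ℰ) j U₁) b)⁻¹)))
        else 0)‖ ≤
      π / 2 * ((ρκ + 2 * aκ * ((((P.L - 1) / 2 + 1 : ℕ) : ℝ) * mR)) +
          (((P.d - 1) * ((P.L - 1) / 2) : ℕ) : ℝ) * ((1 + 2 * (((P.L - 1) / 2 : ℕ) : ℝ)) * ρt)) +
        π / 2 * ((((P.d - 1) * ((P.L - 1) / 2) : ℕ) : ℝ) * ρt) := by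
  have hsF0 : 0 ≤ π / 2 * ((ρκ + 2 * aκ * ((((P.L - 1) / 2 + 1 : ℕ) : ℝ) * mR)) +
          (((P.d - 1) * ((P.L - 1) / 2) : ℕ) : ℝ) * ((1 + 2 * (((P.L - 1) / 2 : ℕ) : ℝ)) * ρt)) := by positivity
  exact pi_norm_disc_trunc_le_perBlock (fun i => blockAvg (P := P) (j := i) ℰ) hj lift g g₀ U U₁ hT4 hT4' pS hρ0
    (fun q hq => hρ q (by obtain ⟨b, hb, hq⟩ := hq; exact ⟨b, hb, Or.inl hq⟩)) hsF0
    (hface_of_letters ℰ hj wt lift g g₀ U U₁ hwt hlift hT4 hT4' hT5 hT5' hcomm pS hmR hρ0 hκrel hκabs hR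
      (fun b hb q hq => hρ q ⟨b, hb, hq⟩))

/-! ## §2 Its square: the per-`B` summand of the discrepancy energy `D′` -/

/-- ★★ **THE PER-`B` DISCREPANCY ENERGY FROM NAMED LETTERS ONLY** (the summand of px20's letter-free `D′` ∕ px21's `D′lam`, squared form of §1):
`‖𝟙[pS ∧ ¬treecomb]·logVec (su2Quat (R_b⁻¹·η_b))‖² ≤ (sF + (π∕2)·((d−1)·((L−1)∕2))·ρ̃)²`. [cite: Balaban1985RegularSpaces, (1.19) p.79, (1.29) p.81; Balaban1989LargeFieldII, p.382] -/
theorem sq_pi_norm_disc_trunc_le_perBlock_of_letters (ℰ : LoopAverage SU2) {j : ℕ} (hj : j + 1 ≤ P.m + P.K)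
    (wt : (i : ℕ) → PBond P i → PBond P (i + 1) → ℝ) (lift : (i : ℕ) → GaugeField P (i + 1) SU2 → GaugeField P i SU2)
    (g g₀ : (i : ℕ) → Site P i → SU2) (U U₁ : GaugeField P 0 SU2)
    (hwt : ∀ b e, wt j b e = if e.dir = b.dir ∧ (b.src b.dir - emb e.src b.dir).val < P.L then
      ∏ ν ∈ Finset.univ.erase b.dir, max 0 (1 - ((rel (emb e.src) b.src ν).natAbs : ℝ) / P.L) else 0)
    (hlift : ∀ (X : GaugeField P (j + 1) SU2) (b : PBond P j), lift j X b = expPoint (∑ e, wt j b e • ((P.L : ℝ)⁻¹ • logVec (su2Quat (X e)))))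
    (hT4 : ∀ x, axialT (GaugeField.gaugeAct (g j) (Averaging.iter (fun i => blockAvg (P := P) (j := i) ℰ) j U)) (emb (blockOf x)) x =
      axialT (lift j (GaugeField.gaugeAct (g (j + 1)) (Averaging.iter (fun i => blockAvg (P := P) (j := i) ℰ) (j + 1) U))) (emb (blockOf x)) x)
    (hT4' : ∀ x, axialT (GaugeField.gaugeAct (g₀ j) (Averaging.iter (fun i => blockAvg (P := P) (j := i) ℰ) j U₁)) (emb (blockOf x)) x =
      axialT (lift j (GaugeField.gaugeAct (g₀ (j + 1)) (Averaging.iter (fun i => blockAvg (P := P) (j := i) ℰ) (j + 1) U₁))) (emb (blockOf x)) x)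
    (hT5 : (blockAvg (P := P) (j := j) ℰ).avg (GaugeField.gaugeAct (g j) (Averaging.iter (fun i => blockAvg (P := P) (j := i) ℰ) j U)) =
      GaugeField.gaugeAct (g (j + 1)) (Averaging.iter (fun i => blockAvg (P := P) (j := i) ℰ) (j + 1) U))
    (hT5' : (blockAvg (P := P) (j := j) ℰ).avg (GaugeField.gaugeAct (g₀ j) (Averaging.iter (fun i => blockAvg (P := P) (j := i) ℰ) j U₁)) =
      GaugeField.gaugeAct (g₀ (j + 1)) (Averaging.iter (fun i => blockAvg (P := P) (j := i) ℰ) (j + 1) U₁))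
    (hcomm : ∀ x y : SU2, dist1 (x * y * x⁻¹ * y⁻¹) ≤ 2 * dist1 x * dist1 y)
    (pS : PBond P j → Prop) [DecidablePred pS] {ρκ aκ mR ρt : ℝ} (hρκ0 : 0 ≤ ρκ) (haκ0 : 0 ≤ aκ) (hmR : 0 ≤ mR) (hρ0 : 0 ≤ ρt)
    (hκrel : ∀ b : PBond P j, pS b → blockOf (b.src.shift b.dir) ≠ blockOf b.src →
      dist1 (corr ℰ (GaugeField.gaugeAct (g j) (Averaging.iter (fun i => blockAvg (P := P) (j := i) ℰ) j U)) ⟨blockOf b.src, b.dir⟩ *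
        (corr ℰ (GaugeField.gaugeAct (g₀ j) (Averaging.iter (fun i => blockAvg (P := P) (j := i) ℰ) j U₁)) ⟨blockOf b.src, b.dir⟩)⁻¹) ≤ ρκ)
    (hκabs : ∀ b : PBond P j, pS b → blockOf (b.src.shift b.dir) ≠ blockOf b.src →
      dist1 (corr ℰ (GaugeField.gaugeAct (g₀ j) (Averaging.iter (fun i => blockAvg (P := P) (j := i) ℰ) j U₁)) ⟨blockOf b.src, b.dir⟩) ≤ aκ)
    (hR : ∀ b : PBond P j, pS b → blockOf (b.src.shift b.dir) ≠ blockOf b.src →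
      dist1 (lift j (GaugeField.gaugeAct (g (j + 1)) (Averaging.iter (fun i => blockAvg (P := P) (j := i) ℰ) (j + 1) U))
            ⟨transl (emb (blockOf b.src)) (fun ν => if ν = b.dir then (((P.L - 1) / 2 : ℕ) : ℤ) else 0), b.dir⟩ *
          (lift j (GaugeField.gaugeAct (g₀ (j + 1)) (Averaging.iter (fun i => blockAvg (P := P) (j := i) ℰ) (j + 1) U₁))
            ⟨transl (emb (blockOf b.src)) (fun ν => if ν = b.dir then (((P.L - 1) / 2 : ℕ) : ℤ) else 0), b.dir⟩)⁻¹) ≤ mR)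
    (hρ : ∀ q : Plaq P j, (∃ b : PBond P j, pS b ∧ (blockOf q.src = blockOf b.src ∨ blockOf q.src = (blockOf b.src).shift b.dir)) →
      dist1 ((GaugeField.plaqHol (fun b => lift j (GaugeField.gaugeAct (g (j + 1)) (Averaging.iter (fun i => blockAvg (P := P) (j := i) ℰ) (j + 1) U)) b *
            (lift j (GaugeField.gaugeAct (g₀ (j + 1)) (Averaging.iter (fun i => blockAvg (P := P) (j := i) ℰ) (j + 1) U₁)) b)⁻¹ *
          GaugeField.gaugeAct (g₀ j) (Averaging.iter (fun i => blockAvg (P := P) (j := i) ℰ) j U₁) b : GaugeField P j SU2) q)⁻¹ *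
        GaugeField.plaqHol (GaugeField.gaugeAct (g j) (Averaging.iter (fun i => blockAvg (P := P) (j := i) ℰ) j U)) q) ≤ ρt) :
    ‖(fun b : PBond P j =>
        if pS b ∧ ¬ (blockOf (b.src.shift b.dir) = blockOf b.src ∧ ∀ ν, ν < b.dir → rel (emb (blockOf b.src)) b.src ν = 0) then
          logVec (su2Quat ((lift j (GaugeField.gaugeAct (g (j + 1)) (Averaging.iter (fun i => blockAvg (P := P) (j := i) ℰ) (j + 1) U)) b *
              (lift j (GaugeField.gaugeAct (g₀ (j + 1)) (Averaging.iter (fun i => blockAvg (P := P) (j := i) ℰ) (j + 1) U₁)) b)⁻¹)⁻¹ *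
            (GaugeField.gaugeAct (g j) (Averaging.iter (fun i => blockAvg (P := P) (j := i) ℰ) j U) b *
              (GaugeField.gaugeAct (g₀ j) (Averaging.iter (fun i => blockAvg (P := P) (j := i) ℰ) j U₁) b)⁻¹)))
        else 0)‖ ^ 2 ≤
      (π / 2 * ((ρκ + 2 * aκ * ((((P.L - 1) / 2 + 1 : ℕ) : ℝ) * mR)) +
          (((P.d - 1) * ((P.L - 1) / 2) : ℕ) : ℝ) * ((1 + 2 * (((P.L - 1) / 2 : ℕ) : ℝ)) * ρt)) +
        π / 2 * ((((P.d - 1) * ((P.L - 1) / 2) : ℕ) : ℝ) * ρt)) ^ 2 :=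
  pow_le_pow_left₀ (norm_nonneg _) (pi_norm_disc_trunc_le_perBlock_of_letters ℰ hj wt lift g g₀ U U₁ hwt hlift hT4 hT4' hT5 hT5' hcomm pS hρκ0 haκ0 hmR hρ0 hκrel hκabs hR hρ) 2

/-! ## §3 The source ∕ feedback split (the per-`B` shape of px21 (iii)'s `hDisc : D′ ≤ X + q·E′`) -/

/-- ★★ **SOURCE ∕ FEEDBACK SPLIT OF THE PER-`B` DISCREPANCY ENERGY**: with the θ-LETTER part `r := (π∕2)·(ρκ + ((d−1)((L−1)∕2))·(2 + 2·((L−1)∕2))·ρ̃)` and the FEEDBACK part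
`m := π·aκ·(((L−1)∕2+1)·mR)` (the lifted relative chord `mR` at the central face bond carries the parent relative field; its factor `aκ` is the θ-small absolute correction), for every
`κ′ > 0`: `‖𝟙[pS ∧ ¬treecomb]·logVec (su2Quat (R_b⁻¹·η_b))‖² ≤ (1+κ′)·r² + (1+κ′⁻¹)·m²`.  Summed over `B` this is the `X t + q·E′lam t` row once `m²` is fed by the lift formula (not here).
[cite: Balaban1985RegularSpaces, (1.19) p.79, (1.29) p.81; Balaban1985Averaging, Prop. 4 (128)-(135) p.37-38; Balaban1989LargeFieldII, p.382] -/
theorem sq_pi_norm_disc_trunc_le_source_add_feedback (ℰ : LoopAverage SU2) {j : ℕ} (hj : j + 1 ≤ P.m + P.K)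
    (wt : (i : ℕ) → PBond P i → PBond P (i + 1) → ℝ) (lift : (i : ℕ) → GaugeField P (i + 1) SU2 → GaugeField P i SU2)
    (g g₀ : (i : ℕ) → Site P i → SU2) (U U₁ : GaugeField P 0 SU2)
    (hwt : ∀ b e, wt j b e = if e.dir = b.dir ∧ (b.src b.dir - emb e.src b.dir).val < P.L then
      ∏ ν ∈ Finset.univ.erase b.dir, max 0 (1 - ((rel (emb e.src) b.src ν).natAbs : ℝ) / P.L) else 0)
    (hlift : ∀ (X : GaugeField P (j + 1) SU2) (b : PBond P j), lift j X b = expPoint (∑ e, wt j b e • ((P.L : ℝ)⁻¹ • logVec (su2Quat (X e)))))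
    (hT4 : ∀ x, axialT (GaugeField.gaugeAct (g j) (Averaging.iter (fun i => blockAvg (P := P) (j := i) ℰ) j U)) (emb (blockOf x)) x =
      axialT (lift j (GaugeField.gaugeAct (g (j + 1)) (Averaging.iter (fun i => blockAvg (P := P) (j := i) ℰ) (j + 1) U))) (emb (blockOf x)) x)
    (hT4' : ∀ x, axialT (GaugeField.gaugeAct (g₀ j) (Averaging.iter (fun i => blockAvg (P := P) (j := i) ℰ) j U₁)) (emb (blockOf x)) x =
      axialT (lift j (GaugeField.gaugeAct (g₀ (j + 1)) (Averaging.iter (fun i => blockAvg (P := P) (j := i) ℰ) (j + 1) U₁))) (emb (blockOf x)) x)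
    (hT5 : (blockAvg (P := P) (j := j) ℰ).avg (GaugeField.gaugeAct (g j) (Averaging.iter (fun i => blockAvg (P := P) (j := i) ℰ) j U)) =
      GaugeField.gaugeAct (g (j + 1)) (Averaging.iter (fun i => blockAvg (P := P) (j := i) ℰ) (j + 1) U))
    (hT5' : (blockAvg (P := P) (j := j) ℰ).avg (GaugeField.gaugeAct (g₀ j) (Averaging.iter (fun i => blockAvg (P := P) (j := i) ℰ) j U₁)) =
      GaugeField.gaugeAct (g₀ (j + 1)) (Averaging.iter (fun i => blockAvg (P := P) (j := i) ℰ) (j + 1) U₁))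
    (hcomm : ∀ x y : SU2, dist1 (x * y * x⁻¹ * y⁻¹) ≤ 2 * dist1 x * dist1 y)
    (pS : PBond P j → Prop) [DecidablePred pS] {ρκ aκ mR ρt : ℝ} (hρκ0 : 0 ≤ ρκ) (haκ0 : 0 ≤ aκ) (hmR : 0 ≤ mR) (hρ0 : 0 ≤ ρt)
    (hκrel : ∀ b : PBond P j, pS b → blockOf (b.src.shift b.dir) ≠ blockOf b.src →
      dist1 (corr ℰ (GaugeField.gaugeAct (g j) (Averaging.iter (fun i => blockAvg (P := P) (j := i) ℰ) j U)) ⟨blockOf b.src, b.dir⟩ *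
        (corr ℰ (GaugeField.gaugeAct (g₀ j) (Averaging.iter (fun i => blockAvg (P := P) (j := i) ℰ) j U₁)) ⟨blockOf b.src, b.dir⟩)⁻¹) ≤ ρκ)
    (hκabs : ∀ b : PBond P j, pS b → blockOf (b.src.shift b.dir) ≠ blockOf b.src →
      dist1 (corr ℰ (GaugeField.gaugeAct (g₀ j) (Averaging.iter (fun i => blockAvg (P := P) (j := i) ℰ) j U₁)) ⟨blockOf b.src, b.dir⟩) ≤ aκ)
    (hR : ∀ b : PBond P j, pS b → blockOf (b.src.shift b.dir) ≠ blockOf b.src →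
      dist1 (lift j (GaugeField.gaugeAct (g (j + 1)) (Averaging.iter (fun i => blockAvg (P := P) (j := i) ℰ) (j + 1) U))
            ⟨transl (emb (blockOf b.src)) (fun ν => if ν = b.dir then (((P.L - 1) / 2 : ℕ) : ℤ) else 0), b.dir⟩ *
          (lift j (GaugeField.gaugeAct (g₀ (j + 1)) (Averaging.iter (fun i => blockAvg (P := P) (j := i) ℰ) (j + 1) U₁))
            ⟨transl (emb (blockOf b.src)) (fun ν => if ν = b.dir then (((P.L - 1) / 2 : ℕ) : ℤ) else 0), b.dir⟩)⁻¹) ≤ mR)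
    (hρ : ∀ q : Plaq P j, (∃ b : PBond P j, pS b ∧ (blockOf q.src = blockOf b.src ∨ blockOf q.src = (blockOf b.src).shift b.dir)) →
      dist1 ((GaugeField.plaqHol (fun b => lift j (GaugeField.gaugeAct (g (j + 1)) (Averaging.iter (fun i => blockAvg (P := P) (j := i) ℰ) (j + 1) U)) b *
            (lift j (GaugeField.gaugeAct (g₀ (j + 1)) (Averaging.iter (fun i => blockAvg (P := P) (j := i) ℰ) (j + 1) U₁)) b)⁻¹ *
          GaugeField.gaugeAct (g₀ j) (Averaging.iter (fun i => blockAvg (P := P) (j := i) ℰ) j U₁) b : GaugeField P j SU2) q)⁻¹ *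
        GaugeField.plaqHol (GaugeField.gaugeAct (g j) (Averaging.iter (fun i => blockAvg (P := P) (j := i) ℰ) j U)) q) ≤ ρt) {κ' : ℝ} (hκ' : 0 < κ') :
    ‖(fun b : PBond P j =>
        if pS b ∧ ¬ (blockOf (b.src.shift b.dir) = blockOf b.src ∧ ∀ ν, ν < b.dir → rel (emb (blockOf b.src)) b.src ν = 0) then
          logVec (su2Quat ((lift j (GaugeField.gaugeAct (g (j + 1)) (Averaging.iter (fun i => blockAvg (P := P) (j := i) ℰ) (j + 1) U)) b *
              (lift j (GaugeField.gaugeAct (g₀ (j + 1)) (Averaging.iter (fun i => blockAvg (P := P) (j := i) ℰ) (j + 1) U₁)) b)⁻¹)⁻¹ *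
            (GaugeField.gaugeAct (g j) (Averaging.iter (fun i => blockAvg (P := P) (j := i) ℰ) j U) b *
              (GaugeField.gaugeAct (g₀ j) (Averaging.iter (fun i => blockAvg (P := P) (j := i) ℰ) j U₁) b)⁻¹)))
        else 0)‖ ^ 2 ≤
      (1 + κ') * (π / 2 * (ρκ + (((P.d - 1) * ((P.L - 1) / 2) : ℕ) : ℝ) * ((2 + 2 * (((P.L - 1) / 2 : ℕ) : ℝ)) * ρt))) ^ 2 +
        (1 + κ'⁻¹) * (π * (aκ * ((((P.L - 1) / 2 + 1 : ℕ) : ℝ) * mR))) ^ 2 := by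
  have h1 := sq_pi_norm_disc_trunc_le_perBlock_of_letters ℰ hj wt lift g g₀ U U₁ hwt hlift hT4 hT4' hT5 hT5' hcomm pS hρκ0 haκ0 hmR hρ0 hκrel hκabs hR hρ
  have hsum : (π / 2 * ((ρκ + 2 * aκ * ((((P.L - 1) / 2 + 1 : ℕ) : ℝ) * mR)) +
          (((P.d - 1) * ((P.L - 1) / 2) : ℕ) : ℝ) * ((1 + 2 * (((P.L - 1) / 2 : ℕ) : ℝ)) * ρt)) +
        π / 2 * ((((P.d - 1) * ((P.L - 1) / 2) : ℕ) : ℝ) * ρt)) =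
      π / 2 * (ρκ + (((P.d - 1) * ((P.L - 1) / 2) : ℕ) : ℝ) * ((2 + 2 * (((P.L - 1) / 2 : ℕ) : ℝ)) * ρt)) +
        π * (aκ * ((((P.L - 1) / 2 + 1 : ℕ) : ℝ) * mR)) := by ring
  rw [hsum] at h1
  refine h1.trans ?_
  -- `(r + m)² ≤ (1+κ′)·r² + (1+κ′⁻¹)·m²`: `κ′·((1+κ′)r² + (1+κ′⁻¹)m² − (r+m)²) = (κ′r − m)² ≥ 0`
  set r : ℝ := π / 2 * (ρκ + (((P.d - 1) * ((P.L - 1) / 2) : ℕ) : ℝ) * ((2 + 2 * (((P.L - 1) / 2 : ℕ) : ℝ)) * ρt)) with hr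
  set m : ℝ := π * (aκ * ((((P.L - 1) / 2 + 1 : ℕ) : ℝ) * mR)) with hm
  have hκinv : κ' * κ'⁻¹ = 1 := mul_inv_cancel₀ hκ'.ne'
  nlinarith [mul_self_nonneg (κ' * r - m), hκ', hκinv, sq_nonneg r, sq_nonneg m,
    mul_nonneg hκ'.le (sq_nonneg m)]

end Summit.QuantumFields.YangMills.Theorems.FluctuationComparisonRegPrIntLS2BetaDiscEnergyPerBlockOfLetters
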